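import Summits.Parity.GeneralizedHardyLittlewood.Theorems.ChenParityOracleBLAPHostParityFromBrickTypeILargePiece
import Summits.Parity.GeneralizedHardyLittlewood.Theorems.ChenParityOracleBLAPHostParityFromBrickTypeILargeSum
import HarnessLib

/-!
# Route `ChenParityOracleBLAP` — crux S1 = `HostParityFromBrick` (stmt-Parity-20045): Type-I sums, large moduli — summing the pieces

Support file for the prime half `K1 → K2 → HP1` of S1 (unconditional Type-I input).  The large
moduli `x^{1/3+ε_T} < d ≤ x^{1/2−ε}` (odd) are cut into pieces of length `L = ⌊x^{1/3}⌋`; on each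
piece `typeI_piece_le` applies with the Barban–Davenport–Halberstam bound (taken here as a
HYPOTHESIS `hBDH` of the shape proved in `…TypeIBDH`, at `X = (x+2)/(D'+1) ≥ √x/3`, level
`2R ≤ X^{3/4}`), and the pieces are summed with `sum_div_arith_prog_le`
(`typeI_large_static`: an explicit bound, all of whose terms are `o(x/(log x)^A)`).

References: E. Bombieri, J. B. Friedlander, H. Iwaniec, Acta Math. 156 (1986), Thm 0
[BombieriFriedlanderIwaniecActa1986]; H. Iwaniec, E. Kowalski, *Analytic Number Theory* (2004),
Thm 17.1, §17.3 [IwaniecKowalski2004].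
-/

namespace Summit.Parity.GeneralizedHardyLittlewood.Theorems

open Finset Real
open ArithmeticFunction (liouville)

/-- Square root of a BDH-type bound: `B ≤ C X²/(log X)^{2A+6}` gives `√B ≤ √C X/(log X)^{A+3}`. -/
theorem sqrt_bdh_le {C X B A : ℝ} (hC : 0 ≤ C) (hX : 1 < X)
    (hB : B ≤ C * X ^ 2 / Real.log X ^ (2 * A + 6)) :
    Real.sqrt B ≤ Real.sqrt C * X / Real.log X ^ (A + 3) := by
  have hl : 0 < Real.log X := Real.log_pos hX
  have ht : 0 ≤ Real.sqrt C * X / Real.log X ^ (A + 3) := by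
    have : 0 < Real.log X ^ (A + 3) := Real.rpow_pos_of_pos hl _
    have : (0 : ℝ) ≤ X := by linarith
    positivity
  calc Real.sqrt B ≤ Real.sqrt (C * X ^ 2 / Real.log X ^ (2 * A + 6)) := Real.sqrt_le_sqrt hB
    _ = Real.sqrt ((Real.sqrt C * X / Real.log X ^ (A + 3)) ^ 2) := by
        congr 1
        rw [div_pow, mul_pow, Real.sq_sqrt hC, ← Real.rpow_mul_natCast hl.le,
          show (A + 3) * ((2 : ℕ) : ℝ) = 2 * A + 6 by push_cast; ring]
    _ = _ := Real.sqrt_sq ht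

set_option maxHeartbeats 400000 in
/-- **Large moduli, static form.**  Assume the BDH bound `hBDH` (exponent `2A+6`, threshold `X₀`).
Let `x ≥ 2^10` with `X₀ ≤ √x/3`, `2·x^{1/3} ≤ (√x/3)^{3/4}`, `u ≤ x`, `R ≤ x^{1/3−ε_T}`
(`0 < ε_T ≤ 1/12`), `0 ≤ ε`, and `lf` a residue selector.  Then
`∑_{x^{1/3+ε_T} < d ≤ x^{1/2−ε}, d odd} ∑_{r ≤ R odd, (d,r)=1} |∑_{v ≤ (r⌊u/r⌋+2)/d, v ≡ lf d r (2r)} λ(v)|`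
is at most `T₁ + T₂ + T₃` with
`T₁ = √C (4/log x)^{A+3} (x+2)(1+log x)(2√(1+log x) + 8 x^{-ε_T})`,
`T₂ = (1+log x)((x+2) x^{-ε_T} (1+log x) + x^{1/3}(1+log x) + 2√x)`, `T₃ = 2 x^{5/6}`. -/
theorem typeI_large_static {A εT ε C X₀ : ℝ} (hA : 0 < A) (hC : 0 < C) (hεT : 0 < εT)
    (hεT' : εT ≤ 1 / 12) (hε : 0 ≤ ε)
    (hBDH : ∀ X : ℝ, X₀ ≤ X → ∀ Q : ℕ, (Q : ℝ) ≤ X ^ (3 / 4 : ℝ) → ∀ V : ℕ, (V : ℝ) ≤ X →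
      ∑ q ∈ Icc 1 Q, ∑ l ∈ (range q).filter (fun l => l.Coprime q),
        (∑ v ∈ (Icc 1 V).filter (fun v : ℕ => (v : ZMod q) = (l : ZMod q)), (liouville v : ℝ)) ^ 2 ≤
        C * X ^ 2 / Real.log X ^ (2 * A + 6))
    {x : ℕ} (hx : (2 : ℝ) ^ 10 ≤ x) (hX₀ : X₀ ≤ Real.sqrt x / 3)
    (h34 : 2 * (x : ℝ) ^ (1 / 3 : ℝ) ≤ (Real.sqrt x / 3) ^ (3 / 4 : ℝ))
    {u : ℕ} (hu : u ≤ x) {R : ℕ} (hR : (R : ℝ) ≤ (x : ℝ) ^ (1 / 3 - εT))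
    (lf : ℕ → ℕ → ℕ)
    (hlf : ∀ d r : ℕ, Odd r → Nat.Coprime d r → Odd (lf d r) ∧ (r : ℤ) ∣ (d : ℤ) * (lf d r) - 2) :
    ∑ d ∈ (Icc 1 ⌊(x : ℝ) ^ (1 / 2 - ε)⌋₊).filter
        (fun d : ℕ => Odd d ∧ (x : ℝ) ^ (1 / 3 + εT) < (d : ℝ)),
      ∑ r ∈ (Icc 1 R).filter (fun r => Odd r ∧ Nat.Coprime d r),
        |∑ v ∈ (Icc 1 ((r * (u / r) + 2) / d)).filter
            (fun v : ℕ => (v : ZMod (2 * r)) = ((lf d r : ℕ) : ZMod (2 * r))), (liouville v : ℝ)| ≤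
      Real.sqrt C * (4 / Real.log x) ^ (A + 3) * ((x : ℝ) + 2) * (1 + Real.log x) *
          (2 * Real.sqrt (1 + Real.log x) + 8 * (x : ℝ) ^ (-εT)) +
        (1 + Real.log x) * (((x : ℝ) + 2) * (x : ℝ) ^ (-εT) * (1 + Real.log x) +
          (x : ℝ) ^ (1 / 3 : ℝ) * (1 + Real.log x) + 2 * Real.sqrt x) +
        2 * (x : ℝ) ^ (5 / 6 : ℝ) := by
  classical
  -- basic quantities
  have hx' : (1024 : ℝ) ≤ x := by have h := hx; norm_num at h; exact_mod_cast h
  have hx1 : (1 : ℝ) < x := by linarith only [hx']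
  have hx0 : (0 : ℝ) < x := by linarith only [hx']
  have hlogx : 0 < Real.log x := Real.log_pos hx1
  have hlog1 : 1 ≤ Real.log x := by
    rw [← Real.log_exp 1]
    refine Real.log_le_log (Real.exp_pos 1) ?_
    have := Real.exp_one_lt_d9; linarith only [this, hx']
  set D : ℕ := ⌊(x : ℝ) ^ (1 / 2 - ε)⌋₊ with hDdef
  set D₁ : ℕ := ⌊(x : ℝ) ^ (1 / 3 + εT)⌋₊ with hD₁def
  set L : ℕ := ⌊(x : ℝ) ^ (1 / 3 : ℝ)⌋₊ with hLdef
  set I : ℕ := D / L + 1 with hIdef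
  set Sset := (Icc 1 D).filter (fun d : ℕ => Odd d ∧ (x : ℝ) ^ (1 / 3 + εT) < (d : ℝ)) with hSset
  set F : ℕ → ℝ := fun d => ∑ r ∈ (Icc 1 R).filter (fun r => Odd r ∧ Nat.Coprime d r),
    |∑ v ∈ (Icc 1 ((r * (u / r) + 2) / d)).filter
      (fun v : ℕ => (v : ZMod (2 * r)) = ((lf d r : ℕ) : ZMod (2 * r))), (liouville v : ℝ)| with hF
  set lx : ℝ := 1 + Real.log x with hlx
  -- sizes: `D ≤ √x`, `D₁ ≤ √x`, `x^{1/3}/2 ≤ L ≤ x^{1/3}`, `L ≤ D₁`, `x^{1/3+εT} ≤ D₁ + 1`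
  have hsqrt : Real.sqrt x = (x : ℝ) ^ (1 / 2 : ℝ) := Real.sqrt_eq_rpow _
  have hDle : (D : ℝ) ≤ Real.sqrt x := by
    rw [hsqrt]; refine (Nat.floor_le (by positivity)).trans ?_
    exact Real.rpow_le_rpow_of_exponent_le hx1.le (by linarith)
  have hD₁le : (D₁ : ℝ) ≤ Real.sqrt x := by
    rw [hsqrt]; refine (Nat.floor_le (by positivity)).trans ?_
    exact Real.rpow_le_rpow_of_exponent_le hx1.le (by linarith)
  have hLle : (L : ℝ) ≤ (x : ℝ) ^ (1 / 3 : ℝ) := Nat.floor_le (by positivity)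
  have hx13 : (2 : ℝ) ≤ (x : ℝ) ^ (1 / 3 : ℝ) := by
    have h8 : (2 : ℝ) ^ (3 : ℝ) = 8 := by
      rw [show (3 : ℝ) = ((3 : ℕ) : ℝ) by norm_num, Real.rpow_natCast]; norm_num
    have : ((2 : ℝ) ^ (3 : ℝ)) ^ (1 / 3 : ℝ) ≤ (x : ℝ) ^ (1 / 3 : ℝ) :=
      Real.rpow_le_rpow (by positivity) (by rw [h8]; linarith only [hx']) (by norm_num)
    rwa [← Real.rpow_mul (by norm_num), show (3 : ℝ) * (1 / 3) = 1 by norm_num, Real.rpow_one] at this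
  have hLge : (x : ℝ) ^ (1 / 3 : ℝ) / 2 ≤ L := by
    have := Nat.lt_floor_add_one ((x : ℝ) ^ (1 / 3 : ℝ))
    rw [← hLdef] at this; linarith only [this, hx13]
  have hL1 : 1 ≤ L := by
    have : (1 : ℝ) ≤ L := by linarith only [hLge, hx13]
    exact_mod_cast this
  have hL2 : 2 ≤ L := by
    have h4 : (4 : ℝ) ≤ (x : ℝ) ^ (1 / 3 : ℝ) := by
      have h64 : (2 : ℝ) ^ (6 : ℝ) = 64 := by
        rw [show (6 : ℝ) = ((6 : ℕ) : ℝ) by norm_num, Real.rpow_natCast]; norm_num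
      have : ((2 : ℝ) ^ (6 : ℝ)) ^ (1 / 3 : ℝ) ≤ (x : ℝ) ^ (1 / 3 : ℝ) :=
        Real.rpow_le_rpow (by positivity) (by rw [h64]; linarith only [hx']) (by norm_num)
      rwa [← Real.rpow_mul (by norm_num), show (6 : ℝ) * (1 / 3) = 2 by norm_num,
        show (2 : ℝ) ^ (2 : ℝ) = 4 by norm_num] at this
    have : (2 : ℝ) ≤ L := by linarith only [hLge, h4]
    exact_mod_cast this
  have hLD₁ : L ≤ D₁ := Nat.floor_le_floor
    (Real.rpow_le_rpow_of_exponent_le hx1.le (by linarith))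
  have hD₁1 : (x : ℝ) ^ (1 / 3 + εT) ≤ (D₁ : ℝ) + 1 := by
    have := Nat.lt_floor_add_one ((x : ℝ) ^ (1 / 3 + εT)); rw [← hD₁def] at this
    linarith only [this]
  have hLsqrt : (L : ℝ) ≤ Real.sqrt x := by
    rw [hsqrt]; exact hLle.trans (Real.rpow_le_rpow_of_exponent_le hx1.le (by norm_num))
  have hRle : (R : ℝ) ≤ (x : ℝ) ^ (1 / 3 : ℝ) :=
    hR.trans (Real.rpow_le_rpow_of_exponent_le hx1.le (by linarith))
  have hRL : (R : ℝ) / L ≤ 2 * (x : ℝ) ^ (-εT) := by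
    have hL0 : (0 : ℝ) < L := by exact_mod_cast hL1
    rw [div_le_iff₀ hL0]
    calc (R : ℝ) ≤ (x : ℝ) ^ (1 / 3 - εT) := hR
      _ = 2 * (x : ℝ) ^ (-εT) * ((x : ℝ) ^ (1 / 3 : ℝ) / 2) := by
          rw [show (1 : ℝ) / 3 - εT = -εT + 1 / 3 by ring, Real.rpow_add hx0]; ring
      _ ≤ 2 * (x : ℝ) ^ (-εT) * L := mul_le_mul_of_nonneg_left hLge (by positivity)
  have hLD₁' : (L : ℝ) / ((D₁ : ℝ) + 1) ≤ (x : ℝ) ^ (-εT) := by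
    rw [div_le_iff₀ (by positivity)]
    calc (L : ℝ) ≤ (x : ℝ) ^ (1 / 3 : ℝ) := hLle
      _ = (x : ℝ) ^ (-εT) * (x : ℝ) ^ (1 / 3 + εT) := by
          rw [← Real.rpow_add hx0]; ring_nf
      _ ≤ (x : ℝ) ^ (-εT) * ((D₁ : ℝ) + 1) := mul_le_mul_of_nonneg_left hD₁1 (by positivity)
  have hlR : 1 + Real.log (max (R : ℝ) 1) ≤ lx := by
    have h1 : max (R : ℝ) 1 ≤ x := max_le (hRle.trans ((Real.rpow_le_rpow_of_exponent_le hx1.le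
      (show (1:ℝ)/3 ≤ 1 by norm_num)).trans (by rw [Real.rpow_one]))) hx1.le
    have := Real.log_le_log (by positivity) h1
    simp only [hlx]; linarith only [this]
  have hlR0 : 0 ≤ Real.log (max (R : ℝ) 1) := Real.log_nonneg (le_max_right _ _)
  -- the decomposition into pieces
  set idx : ℕ → ℕ := fun d => (d - D₁ - 1) / L with hidx
  set P : ℕ → Finset ℕ := fun i => Sset.filter (fun d => idx d = i) with hPdef
  have hSD₁ : ∀ d ∈ Sset, D₁ < d ∧ d ≤ D := by
    intro d hd
    rw [hSset, Finset.mem_filter, Finset.mem_Icc] at hd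
    refine ⟨?_, hd.1.2⟩
    have : (D₁ : ℝ) < d := (Nat.floor_le (by positivity)).trans_lt hd.2.2
    exact_mod_cast this
  have hmaps : ∀ d ∈ Sset, idx d ∈ range I := by
    intro d hd
    rw [Finset.mem_range, hIdef]
    exact piece_index_lt (hSD₁ d hd).2
  have hPsub : ∀ i, P i ⊆ Ioc (D₁ + i * L) (D₁ + i * L + L) := by
    intro i d hd
    rw [hPdef, Finset.mem_filter] at hd
    exact mem_piece_Ioc hL1 (hSD₁ d hd.1).1 hd.2
  have hdecomp : ∑ d ∈ Sset, F d = ∑ i ∈ range I, ∑ d ∈ P i, F d :=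
    (Finset.sum_fiberwise_of_maps_to hmaps F).symm
  have hcardS : #Sset ≤ D := (Finset.card_filter_le _ _).trans (by simp)
  have hcardP : ∀ i, #(P i) ≤ L := fun i =>
    (Finset.card_le_card (hPsub i)).trans (by rw [Nat.card_Ioc]; omega)
  have hsumcardP : ∑ i ∈ range I, (#(P i) : ℝ) = #Sset := by
    rw [Finset.card_eq_sum_card_fiberwise hmaps]; push_cast; rfl
  clear_value D D₁ L I lx Sset
  -- the piece bound
  have hpiece : ∀ i ∈ range I, ∑ d ∈ P i, F d ≤
      (2 * L * Real.sqrt lx + 4 * R) * (Real.sqrt C * (((x : ℝ) + 2) / ((D₁ : ℝ) + 1 + i * L)) *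
        (4 / Real.log x) ^ (A + 3)) +
      (L * ((((x : ℝ) + 2) * L / ((D₁ : ℝ) + 1 + i * L) ^ 2 + (R : ℝ) / ((D₁ : ℝ) + 1 + i * L) + 1) * lx)
        + #(P i) * (2 * R)) := by
    intro i _
    set D' : ℕ := D₁ + i * L with hD'
    set V₀ : ℕ := (u + 3 - R) / (D' + L) with hV₀
    set H : ℕ := (u + 2) / (D' + 1) - (u + 3 - R) / (D' + L) with hH
    have hP' : P i ⊆ Ioc D' (D' + L) := hPsub i
    have hV : ∀ d ∈ P i, ∀ r ∈ Icc 1 R, V₀ ≤ (r * (u / r) + 2) / d ∧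
        (r * (u / r) + 2) / d ≤ V₀ + H := fun d hd r hr => height_window (hP' hd) hr
    have hmain := typeI_piece_le (R := R) hP' lf (fun d _ r hr hc => hlf d r hr hc)
      (fun d r => (r * (u / r) + 2) / d) hV
    -- the BDH input at `X = (x+2)/(D'+1)`
    set X : ℝ := ((x : ℝ) + 2) / ((D' : ℝ) + 1) with hXdef
    have hD'le : (D' : ℝ) + 1 ≤ 3 * Real.sqrt x := by
      have hi : i * L ≤ D / L * L := by
        have : i < I := Finset.mem_range.mp ‹i ∈ range I›
        exact Nat.mul_le_mul_right L (by omega)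
      have hi' : ((i * L : ℕ) : ℝ) ≤ D := by exact_mod_cast hi.trans (Nat.div_mul_le_self D L)
      have h1 : (1 : ℝ) ≤ Real.sqrt x := by rw [hsqrt]; exact Real.one_le_rpow hx1.le (by norm_num)
      simp only [hD']; push_cast at hi' ⊢; linarith only [hi', hDle, hD₁le, h1]
    have hsq32 : (32 : ℝ) ≤ Real.sqrt x := by
      have h1 : Real.sqrt 1024 = 32 := by
        rw [show (1024 : ℝ) = 32 ^ 2 by norm_num]; exact Real.sqrt_sq (by norm_num)
      rw [← h1]; exact Real.sqrt_le_sqrt hx'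
    have hxx : Real.sqrt x * Real.sqrt x = x := Real.mul_self_sqrt hx0.le
    have hD'x : (D' : ℝ) + 1 ≤ x := by
      calc (D' : ℝ) + 1 ≤ 3 * Real.sqrt x := hD'le
        _ ≤ Real.sqrt x * Real.sqrt x := by nlinarith only [hsq32]
        _ = x := hxx
    have hXge : Real.sqrt x / 3 ≤ X := by
      rw [hXdef, le_div_iff₀ (by positivity)]
      calc Real.sqrt x / 3 * ((D' : ℝ) + 1) ≤ Real.sqrt x / 3 * (3 * Real.sqrt x) :=
            mul_le_mul_of_nonneg_left hD'le (by positivity)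
        _ = x := by
            rw [show Real.sqrt x / 3 * (3 * Real.sqrt x) = Real.sqrt x * Real.sqrt x by ring, hxx]
        _ ≤ (x : ℝ) + 2 := by linarith only
    have hX1 : 1 < X := by linarith only [hsq32, hXge]
    have hX₀X : X₀ ≤ X := hX₀.trans hXge
    have hQ : ((2 * R : ℕ) : ℝ) ≤ X ^ (3 / 4 : ℝ) := by
      push_cast
      calc 2 * (R : ℝ) ≤ 2 * (x : ℝ) ^ (1 / 3 : ℝ) := by linarith only [hRle]
        _ ≤ (Real.sqrt x / 3) ^ (3 / 4 : ℝ) := h34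
        _ ≤ X ^ (3 / 4 : ℝ) := Real.rpow_le_rpow (by positivity) hXge (by norm_num)
    have hV₀X : (V₀ : ℝ) ≤ X := by
      have h1 : (V₀ : ℝ) ≤ ((u + 3 - R : ℕ) : ℝ) / ((D' + L : ℕ) : ℝ) := Nat.cast_div_le
      refine h1.trans ?_
      rw [hXdef, div_le_div_iff₀ (by positivity) (by positivity)]
      have h2 : ((u + 3 - R : ℕ) : ℝ) ≤ (u : ℝ) + 3 := by
        have : u + 3 - R ≤ u + 3 := Nat.sub_le _ _
        exact_mod_cast this
      have hux : (u : ℝ) ≤ x := by exact_mod_cast hu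
      have hL2' : (2 : ℝ) ≤ L := by exact_mod_cast hL2
      have hD'0 : (0 : ℝ) ≤ D' := Nat.cast_nonneg _
      push_cast
      calc ((u + 3 - R : ℕ) : ℝ) * ((D' : ℝ) + 1) ≤ ((x : ℝ) + 3) * ((D' : ℝ) + 1) :=
            mul_le_mul_of_nonneg_right (by linarith only [h2, hux]) (by positivity)
        _ ≤ ((x : ℝ) + 2) * ((D' : ℝ) + L) := by nlinarith only [hL2', hD'0, hD'x, hx']
    have hB := hBDH X hX₀X (2 * R) hQ V₀ hV₀X
    have hsq := sqrt_bdh_le hC.le hX1 hB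
    -- `(log X)^{A+3} ≥ (log x/4)^{A+3}`
    have hlogX : Real.log x / 4 ≤ Real.log X := by
      have h1 : Real.log (Real.sqrt x / 3) ≤ Real.log X := Real.log_le_log (by positivity) hXge
      rw [Real.log_div (by positivity) (by norm_num), Real.log_sqrt hx0.le] at h1
      have h3 : Real.log 3 ≤ Real.log x / 4 := by
        have : Real.log ((3 : ℝ) ^ 4) ≤ Real.log x :=
          Real.log_le_log (by norm_num) (by norm_num at hx ⊢; linarith)
        rw [Real.log_pow] at this; push_cast at this; linarith only [this]
      linarith only [h1, h3]
    have hsq' : Real.sqrt C * X / Real.log X ^ (A + 3) ≤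
        Real.sqrt C * X * (4 / Real.log x) ^ (A + 3) := by
      have hden : (Real.log x / 4) ^ (A + 3) ≤ Real.log X ^ (A + 3) :=
        Real.rpow_le_rpow (by positivity) hlogX (by positivity)
      have hpos : 0 < (Real.log x / 4) ^ (A + 3) := Real.rpow_pos_of_pos (by positivity) _
      have hX0 : 0 ≤ X := by linarith only [hX1]
      calc Real.sqrt C * X / Real.log X ^ (A + 3) ≤ Real.sqrt C * X / (Real.log x / 4) ^ (A + 3) :=
            div_le_div_of_nonneg_left (by positivity) hpos hden
        _ = Real.sqrt C * X * (4 / Real.log x) ^ (A + 3) := by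
            rw [Real.div_rpow hlogx.le (by norm_num : (0:ℝ) ≤ 4),
              Real.div_rpow (by norm_num : (0:ℝ) ≤ 4) hlogx.le, div_eq_mul_inv, inv_div]
    have hW0 : 0 ≤ 2 * (L : ℝ) * Real.sqrt (1 + Real.log (max (R : ℝ) 1)) + 4 * R := by positivity
    have hW : 2 * (L : ℝ) * Real.sqrt (1 + Real.log (max (R : ℝ) 1)) + 4 * R ≤
        2 * L * Real.sqrt lx + 4 * R := by
      gcongr
    have hHle := height_window_H_le (D' := D') (R := R) hL1 hu
    have hq : (D' : ℝ) + 1 = (D₁ : ℝ) + 1 + i * L := by simp only [hD']; push_cast; ring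
    rw [hq] at hHle
    have hXq : X = ((x : ℝ) + 2) / ((D₁ : ℝ) + 1 + i * L) := by rw [hXdef, hq]
    rw [← hXq]
    refine hmain.trans (add_le_add (mul_le_mul hW (hsq.trans hsq') (Real.sqrt_nonneg _)
      (hW0.trans hW)) ?_)
    rw [mul_add]
    refine add_le_add ?_ le_rfl
    have hc : (#(P i) : ℝ) ≤ L := by exact_mod_cast hcardP i
    calc (#(P i) : ℝ) * (H * (1 + Real.log (max (R : ℝ) 1)))
        ≤ L * (H * (1 + Real.log (max (R : ℝ) 1))) :=
          mul_le_mul_of_nonneg_right hc (by positivity)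
      _ ≤ L * ((((x : ℝ) + 2) * L / ((D₁ : ℝ) + 1 + i * L) ^ 2 +
          (R : ℝ) / ((D₁ : ℝ) + 1 + i * L) + 1) * lx) := by
          gcongr
  -- summing the pieces
  clear_value P idx F
  clear hBDH h34 hX₀
  set q : ℕ → ℝ := fun i => (D₁ : ℝ) + 1 + i * L with hq
  set g : ℕ → ℝ := fun i => (L : ℝ) / q i with hg
  set κ : ℝ := (4 / Real.log x) ^ (A + 3) with hκ
  set W : ℝ := 2 * L * Real.sqrt lx + 4 * R with hWdef
  have hκ0 : 0 ≤ κ := by rw [hκ]; positivity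
  clear_value κ W
  have hL0 : (0 : ℝ) < L := by exact_mod_cast hL1
  have hq0 : ∀ i, (D₁ : ℝ) + 1 ≤ q i := fun i => by
    rw [hq]; nlinarith only [hL0.le, (Nat.cast_nonneg i : (0:ℝ) ≤ i)]
  have hqpos : ∀ i, 0 < q i := fun i => lt_of_lt_of_le (by positivity) (hq0 i)
  have hg0 : ∀ i, 0 ≤ g i := fun i => by rw [hg]; exact div_nonneg hL0.le (hqpos i).le
  have hlx1 : 1 ≤ lx := by rw [hlx]; linarith only [hlogx]
  have hW0' : 0 ≤ W := by rw [hWdef]; positivity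
  -- `∑ g ≤ lx`
  have hsumg : ∑ i ∈ range I, g i ≤ lx := by
    have h1 := sum_div_arith_prog_le (a := D₁ + 1) hL1 (by omega) I
    have h2 : ∑ i ∈ range I, g i = ∑ i ∈ range I, (L : ℝ) / (((D₁ + 1 : ℕ) : ℝ) + i * L) := by
      refine Finset.sum_congr rfl fun i _ => ?_; rw [hg, hq]; push_cast; ring_nf
    rw [h2]
    refine h1.trans ?_
    rw [hlx]
    have hIL : (((D₁ + 1 : ℕ) : ℝ) + I * L) ≤ x := by
      have hI : ((I : ℕ) : ℝ) * L ≤ D + L := by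
        have : I * L ≤ D + L := by
          rw [hIdef, add_mul, one_mul]; exact Nat.add_le_add_right (Nat.div_mul_le_self D L) L
        exact_mod_cast this
      have hsq32 : (32 : ℝ) ≤ Real.sqrt x := by
        have h1 : Real.sqrt 1024 = 32 := by
          rw [show (1024 : ℝ) = 32 ^ 2 by norm_num]; exact Real.sqrt_sq (by norm_num)
        rw [← h1]; exact Real.sqrt_le_sqrt hx'
      have hxx : Real.sqrt x * Real.sqrt x = x := Real.mul_self_sqrt hx0.le
      push_cast
      nlinarith only [hI, hDle, hD₁le, hLsqrt, hsq32, hxx]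
    have := Real.log_le_log (by positivity) hIL
    linarith only [this]
  -- termwise bound by a multiple of `g i`
  set Kc : ℝ := W * Real.sqrt C * κ * ((x : ℝ) + 2) / L +
    lx * (((x : ℝ) + 2) * (x : ℝ) ^ (-εT) + R) with hKc
  have hKc0 : 0 ≤ Kc := by rw [hKc]; positivity
  clear_value Kc
  have hterm : ∀ i ∈ range I,
      W * (Real.sqrt C * (((x : ℝ) + 2) / q i) * κ) +
        (L * ((((x : ℝ) + 2) * L / q i ^ 2 + (R : ℝ) / q i + 1) * lx) + #(P i) * (2 * R)) ≤
      Kc * g i + lx * L + 2 * R * #(P i) := by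
    intro i _
    have hqi := hqpos i
    have e1 : ((x : ℝ) + 2) / q i = ((x : ℝ) + 2) / L * g i := by
      rw [hg]; field_simp
    have e2 : (L : ℝ) * (((x : ℝ) + 2) * L / q i ^ 2) = ((x : ℝ) + 2) * g i * ((L : ℝ) / q i) := by
      rw [hg]; field_simp
    have e3 : (L : ℝ) * ((R : ℝ) / q i) = R * g i := by rw [hg]; field_simp
    have hLq : (L : ℝ) / q i ≤ (x : ℝ) ^ (-εT) :=
      (div_le_div_of_nonneg_left hL0.le (by positivity) (hq0 i)).trans hLD₁'
    have h4 : ((x : ℝ) + 2) * g i * ((L : ℝ) / q i) ≤ ((x : ℝ) + 2) * g i * (x : ℝ) ^ (-εT) :=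
      mul_le_mul_of_nonneg_left hLq (by have := hg0 i; positivity)
    calc W * (Real.sqrt C * (((x : ℝ) + 2) / q i) * κ) +
          (L * ((((x : ℝ) + 2) * L / q i ^ 2 + (R : ℝ) / q i + 1) * lx) + #(P i) * (2 * R))
        = W * Real.sqrt C * κ * ((x : ℝ) + 2) / L * g i +
          (lx * ((L : ℝ) * (((x : ℝ) + 2) * L / q i ^ 2) + (L : ℝ) * ((R : ℝ) / q i)) + lx * L +
            2 * R * #(P i)) := by rw [e1]; ring
      _ = W * Real.sqrt C * κ * ((x : ℝ) + 2) / L * g i +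
          (lx * (((x : ℝ) + 2) * g i * ((L : ℝ) / q i) + R * g i) + lx * L + 2 * R * #(P i)) := by
          rw [e2, e3]
      _ ≤ W * Real.sqrt C * κ * ((x : ℝ) + 2) / L * g i +
          (lx * (((x : ℝ) + 2) * g i * (x : ℝ) ^ (-εT) + R * g i) + lx * L + 2 * R * #(P i)) := by
          have := mul_le_mul_of_nonneg_left (add_le_add_right h4 (R * g i))
            (zero_le_one.trans hlx1)
          linarith only [this]
      _ = Kc * g i + lx * L + 2 * R * #(P i) := by rw [hKc]; ring
  have hsum1 : ∑ i ∈ range I, (W * (Real.sqrt C * (((x : ℝ) + 2) / q i) * κ) +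
      (L * ((((x : ℝ) + 2) * L / q i ^ 2 + (R : ℝ) / q i + 1) * lx) + #(P i) * (2 * R))) ≤
      Kc * lx + lx * L * I + 2 * R * D := by
    refine (Finset.sum_le_sum hterm).trans ?_
    rw [Finset.sum_add_distrib, Finset.sum_add_distrib, ← Finset.mul_sum, ← Finset.mul_sum,
      Finset.sum_const, Finset.card_range, nsmul_eq_mul]
    rw [← Finset.mul_sum, hsumcardP]
    have hS : (#Sset : ℝ) ≤ D := by exact_mod_cast hcardS
    nlinarith only [mul_le_mul_of_nonneg_left hsumg hKc0, mul_le_mul_of_nonneg_left hS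
      (by positivity : (0:ℝ) ≤ 2 * R), hlx1, hL0]
  rw [hdecomp]
  refine ((Finset.sum_le_sum hpiece).trans hsum1).trans ?_
  -- final comparison with `T₁ + T₂ + T₃`
  have hWL : W / L ≤ 2 * Real.sqrt lx + 8 * (x : ℝ) ^ (-εT) := by
    rw [hWdef, add_div, show 2 * (L : ℝ) * Real.sqrt lx / L = 2 * Real.sqrt lx by field_simp,
      show (4 : ℝ) * R / L = 4 * ((R : ℝ) / L) by ring]
    linarith only [hRL]
  have hIL' : (L : ℝ) * I ≤ 2 * Real.sqrt x := by
    have : I * L ≤ D + L := by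
      rw [hIdef, add_mul, one_mul]; exact Nat.add_le_add_right (Nat.div_mul_le_self D L) L
    have h' : ((I * L : ℕ) : ℝ) ≤ D + L := by exact_mod_cast this
    push_cast at h'; linarith only [h', hDle, hLsqrt]
  have hRD : 2 * (R : ℝ) * D ≤ 2 * (x : ℝ) ^ (5 / 6 : ℝ) := by
    have h1 : (R : ℝ) * D ≤ (x : ℝ) ^ (1 / 3 : ℝ) * (x : ℝ) ^ (1 / 2 : ℝ) :=
      mul_le_mul hRle (by rwa [hsqrt] at hDle) (by positivity) (by positivity)
    rw [← Real.rpow_add hx0, show (1 : ℝ) / 3 + 1 / 2 = 5 / 6 by norm_num] at h1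
    linarith only [h1]
  have hT1 : W * Real.sqrt C * κ * ((x : ℝ) + 2) / L * lx ≤
      Real.sqrt C * κ * ((x : ℝ) + 2) * lx * (2 * Real.sqrt lx + 8 * (x : ℝ) ^ (-εT)) := by
    have : W * Real.sqrt C * κ * ((x : ℝ) + 2) / L * lx =
        Real.sqrt C * κ * ((x : ℝ) + 2) * lx * (W / L) := by field_simp
    rw [this]
    exact mul_le_mul_of_nonneg_left hWL (by positivity)
  have hT2a : lx * (((x : ℝ) + 2) * (x : ℝ) ^ (-εT) + R) * lx ≤
      lx * (((x : ℝ) + 2) * (x : ℝ) ^ (-εT) * lx + (x : ℝ) ^ (1 / 3 : ℝ) * lx) := by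
    have : lx * (((x : ℝ) + 2) * (x : ℝ) ^ (-εT) + R) * lx =
        lx * (((x : ℝ) + 2) * (x : ℝ) ^ (-εT) * lx + R * lx) := by ring
    rw [this]; gcongr
  have hKclx : Kc * lx = W * Real.sqrt C * κ * ((x : ℝ) + 2) / L * lx +
      lx * (((x : ℝ) + 2) * (x : ℝ) ^ (-εT) + R) * lx := by rw [hKc]; ring
  rw [hKclx]
  nlinarith only [hT1, hT2a, hIL', hRD, hlx1]

end Summit.Parity.GeneralizedHardyLittlewood.Theorems
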